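import Mathlib
import HarnessLib.Audit
import Summits.PneNP.PneNP.Theorems.PstarPathRank
import Summits.PneNP.PneNP.Theorems.PstarForcing

/-!
# A NOR-forced chord, I: the polar form of a NOR certificate has rank exactly four (ROUND-24, memo §9 R7/R8, O5)

FRONTIER range-avoidance ladder, rung F-N3, ROUND 24 (cell `pnp-ideate`, planner memo `r24/CORE-BOUND-NOTES.md` §9 R7 (NOR case), §10
(O5 "composite literals"), §13 proof plan; restricted-model proof complexity — nothing here bears on `P` versus `NP`).

Input: the NOR case of `PstarChordForcing.forced_chord_cases` for ONE chord, read on the instance — a family `P` of outputs (the chord's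
fundamental path) of a pure `P⋆` instance with simple overlaps whose AND-sum `Q_P(x) = Σ_{j ∈ P} x_{α_j} x_{β_j}` satisfies

  `Q_P(x) + c = μ₁(x)·m₁(x) + μ₂(x)·m₂(x)`      (`μ_i, m_i` affine; in `forced_chord_cases`, `μ_i = λ_i + 1`).

Writing `ℓ_i, n_i` for the linear parts (`PstarRankRigidityTwo.linPart`):

* `polar_eq` — the polar (adjacency) form of `Q_P` is `B_P = sym(ℓ₁ ⊗ n₁) + sym(ℓ₂ ⊗ n₂)`; hence (`le_finrank_rad_add_four`) its radical
  contains `kers = ker ℓ₁ ∩ ker n₁ ∩ ker ℓ₂ ∩ ker n₂` and has codimension `≤ 4`; with the rank hypothesis `codim ≥ 4` of `forced_chord_cases`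
  (from `PstarPathRank.rank_four_of_family`) the radical IS `kers` (`rad_eq_kers`), so (`exists_mem_andPair_of_lit`) every LITERAL variable —
  one with `ℓ₁(e_v) ≠ 0` or `ℓ₂(e_v) ≠ 0` — is an AND variable of `P`: **no literal lives off the path** (the first half of O5);
* `adj_eq` — for any two variables, `ℓ₁(e_v)n₁(e_w) + ℓ₁(e_w)n₁(e_v) + ℓ₂(e_v)n₂(e_w) + ℓ₂(e_w)n₂(e_v) = [v, w AND-adjacent in P]`
  (with `PstarPathRank.polar_basis`): the "type" `θ_v = (ℓ₁, ℓ₂, n₁, n₂)(e_v) ∈ 𝔽₂⁴` of a variable determines its adjacency through the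
  hyperbolic form on `𝔽₂⁴`;
* `card_le_two_of_isInducedMatching` — `P`'s AND graph has NO INDUCED MATCHING OF SIZE THREE (`PstarProductRank.ker_inf_span_eq_bot`: the
  coordinate span of an induced matching meets the radical trivially, so `2·|M| ≤ codim rad ≤ 4`);
* `two_le_card` — the rank hypothesis alone forces `|P| ≥ 2`.

The sequel `PstarNorUnitGraph` turns "no induced 3-matching + 3/2-expansion of the cycle family" into the structure `2K₂` or cherry-plus-edge,
and `PstarNorUnit` finishes with the literal products' outputs.
-/

set_option linter.dupNamespace false -- `Summit.PneNP.PneNP.…`: summit = sub-problem name (D-0017 single-conjunct layout)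

open Finset Module Literature.Computability.Complexity
open Summit.PneNP.PneNP.Theorems.PstarGapLinearised (andPair)
open Summit.PneNP.PneNP.Theorems.PstarChordEndgameTools (mem_andPair_iff)
open Summit.PneNP.PneNP.Theorems.PstarSALevel (SimpleOverlap)
open Summit.PneNP.PneNP.Theorems.PstarCubeIdeals (IsAffineFn)
open Summit.PneNP.PneNP.Theorems.PstarLagrangian (finrank_le_finrank_inf_ker_add_one)
open Summit.PneNP.PneNP.Theorems.PstarQuadRank (rad mem_rad)
open Summit.PneNP.PneNP.Theorems.PstarRankRigidityTwo (linPart symForm symForm_apply linPart_apply affine_mul_polar)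
open Summit.PneNP.PneNP.Theorems.PstarForcing (polar_unique)
open Summit.PneNP.PneNP.Theorems.PstarProductRank (qform polar polar_apply qform_add IsInducedMatching cover mem_cover)
open Summit.PneNP.PneNP.Theorems.PstarPathRank (AndAdj polar_basis)

namespace Summit.PneNP.PneNP.Theorems.PstarNorUnitPolar

variable {n m : ℕ}

/-! ## The polar form of a NOR certificate -/

section Algebra

variable {I : LocalMap 4 n m} {P : Finset (Fin m)} {μ₁ μ₂ m₁ m₂ : (Fin n → ZMod 2) → ZMod 2}
  (hμ₁ : IsAffineFn μ₁) (hμ₂ : IsAffineFn μ₂) (hm₁ : IsAffineFn m₁) (hm₂ : IsAffineFn m₂) {c : ZMod 2}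
  (hQ : ∀ x, qform P (fun j => I.vars j 2) (fun j => I.vars j 3) x + c = μ₁ x * m₁ x + μ₂ x * m₂ x)

include hμ₁ hμ₂ hm₁ hm₂ hQ

/-- **The polar form of a NOR certificate**: `B_P = sym(ℓ₁ ⊗ n₁) + sym(ℓ₂ ⊗ n₂)`. -/
theorem polar_eq : polar P (fun j => I.vars j 2) (fun j => I.vars j 3) =
    symForm (linPart hμ₁) (linPart hm₁) + symForm (linPart hμ₂) (linPart hm₂) := by
  set Q : (Fin n → ZMod 2) → ZMod 2 := qform P (fun j => I.vars j 2) (fun j => I.vars j 3) with hQdef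
  have hQ0 : Q 0 = 0 := by simp only [hQdef, qform, Pi.zero_apply, mul_zero, sum_const_zero]
  have hB : ∀ x w, Q (x + w) = Q x + Q w + Q 0 + polar P (fun j => I.vars j 2) (fun j => I.vars j 3) x w := by
    intro x w; rw [hQ0, add_zero]; exact qform_add P _ _ x w
  have hQ' : ∀ x, Q x = μ₁ x * m₁ x + μ₂ x * m₂ x + c := by
    intro x
    have h := hQ x
    have e : ∀ s t k : ZMod 2, s + k = t → s = t + k := by decide
    exact e _ _ _ h
  have hB' : ∀ x w, Q (x + w) = Q x + Q w + Q 0 +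
      (symForm (linPart hμ₁) (linPart hm₁) + symForm (linPart hμ₂) (linPart hm₂)) x w := by
    intro x w
    rw [LinearMap.add_apply, LinearMap.add_apply, hQ', hQ', hQ', hQ', affine_mul_polar hμ₁ hm₁, affine_mul_polar hμ₂ hm₂]
    generalize μ₁ x * m₁ x = s₁; generalize μ₁ w * m₁ w = s₁'; generalize μ₁ 0 * m₁ 0 = s₁₀
    generalize μ₂ x * m₂ x = s₂; generalize μ₂ w * m₂ w = s₂'; generalize μ₂ 0 * m₂ 0 = s₂₀
    generalize symForm (linPart hμ₁) (linPart hm₁) x w = t₁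
    generalize symForm (linPart hμ₂) (linPart hm₂) x w = t₂
    generalize c = k
    revert s₁ s₁' s₁₀ s₂ s₂' s₂₀ t₁ t₂ k; decide
  exact polar_unique hB hB'

omit hQ in
/-- Membership in the common kernel `kers = ker ℓ₁ ∩ ker n₁ ∩ ker ℓ₂ ∩ ker n₂` of the four linear parts. -/
theorem mem_kers {x : Fin n → ZMod 2} :
    x ∈ ((⊤ : Submodule (ZMod 2) (Fin n → ZMod 2)) ⊓ LinearMap.ker (linPart hμ₁) ⊓ LinearMap.ker (linPart hm₁) ⊓ LinearMap.ker (linPart hμ₂) ⊓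
        LinearMap.ker (linPart hm₂)) ↔ linPart hμ₁ x = 0 ∧ linPart hm₁ x = 0 ∧ linPart hμ₂ x = 0 ∧ linPart hm₂ x = 0 := by
  simp only [Submodule.mem_inf, Submodule.mem_top, true_and, LinearMap.mem_ker, and_assoc]

omit hQ in
/-- `kers` has codimension at most four. -/
theorem le_finrank_kers_add_four :
    n ≤ finrank (ZMod 2) ↥((⊤ : Submodule (ZMod 2) (Fin n → ZMod 2)) ⊓ LinearMap.ker (linPart hμ₁) ⊓ LinearMap.ker (linPart hm₁) ⊓
        LinearMap.ker (linPart hμ₂) ⊓ LinearMap.ker (linPart hm₂)) + 4 := by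
  have h1 := finrank_le_finrank_inf_ker_add_one (⊤ : Submodule (ZMod 2) (Fin n → ZMod 2)) (linPart hμ₁)
  have h2 := finrank_le_finrank_inf_ker_add_one (⊤ ⊓ LinearMap.ker (linPart hμ₁)) (linPart hm₁)
  have h3 := finrank_le_finrank_inf_ker_add_one (⊤ ⊓ LinearMap.ker (linPart hμ₁) ⊓ LinearMap.ker (linPart hm₁)) (linPart hμ₂)
  have h4 := finrank_le_finrank_inf_ker_add_one
    (⊤ ⊓ LinearMap.ker (linPart hμ₁) ⊓ LinearMap.ker (linPart hm₁) ⊓ LinearMap.ker (linPart hμ₂)) (linPart hm₂)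
  have hn : finrank (ZMod 2) (⊤ : Submodule (ZMod 2) (Fin n → ZMod 2)) = n := by
    rw [finrank_top, Module.finrank_pi, Fintype.card_fin]
  omega

/-- `kers ≤ rad B_P`. -/
theorem kers_le_rad :
    ((⊤ : Submodule (ZMod 2) (Fin n → ZMod 2)) ⊓ LinearMap.ker (linPart hμ₁) ⊓ LinearMap.ker (linPart hm₁) ⊓ LinearMap.ker (linPart hμ₂) ⊓
        LinearMap.ker (linPart hm₂)) ≤
      rad (polar P (fun j => I.vars j 2) (fun j => I.vars j 3)) := by
  intro x hx
  rw [mem_kers] at hx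
  rw [mem_rad, polar_eq hμ₁ hμ₂ hm₁ hm₂ hQ]
  intro y
  rw [LinearMap.add_apply, LinearMap.add_apply, symForm_apply, symForm_apply, hx.1, hx.2.1, hx.2.2.1, hx.2.2.2]
  ring

/-- **The radical of `B_P` has codimension at most four.** -/
theorem le_finrank_rad_add_four : n ≤ finrank (ZMod 2) (rad (polar P (fun j => I.vars j 2) (fun j => I.vars j 3))) + 4 :=
  (le_finrank_kers_add_four hμ₁ hμ₂ hm₁ hm₂).trans
    (Nat.add_le_add_right (Submodule.finrank_mono (kers_le_rad hμ₁ hμ₂ hm₁ hm₂ hQ)) 4)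

/-- With the rank hypothesis (`codim rad ≥ 4`) the radical IS the common kernel of the four linear parts. -/
theorem rad_eq_kers (hrank : finrank (ZMod 2) (rad (polar P (fun j => I.vars j 2) (fun j => I.vars j 3))) + 4 ≤
      finrank (ZMod 2) (Fin n → ZMod 2)) :
    rad (polar P (fun j => I.vars j 2) (fun j => I.vars j 3)) =
      ((⊤ : Submodule (ZMod 2) (Fin n → ZMod 2)) ⊓ LinearMap.ker (linPart hμ₁) ⊓ LinearMap.ker (linPart hm₁) ⊓ LinearMap.ker (linPart hμ₂) ⊓
        LinearMap.ker (linPart hm₂)) := by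
  have hn : finrank (ZMod 2) (Fin n → ZMod 2) = n := by rw [Module.finrank_pi, Fintype.card_fin]
  rw [hn] at hrank
  have hle := kers_le_rad hμ₁ hμ₂ hm₁ hm₂ hQ
  have h4 := le_finrank_kers_add_four hμ₁ hμ₂ hm₁ hm₂
  exact (Submodule.eq_of_le_of_finrank_le hle (by omega)).symm

omit hμ₁ hμ₂ hm₁ hm₂ hQ in
/-- A variable held by no output of `P` in an AND slot gives a coordinate vector in the radical of `B_P`. -/
theorem single_mem_rad {v : Fin n} (hv : ∀ j ∈ P, v ∉ andPair I j) :
    (Pi.single v (1 : ZMod 2) : Fin n → ZMod 2) ∈ rad (polar P (fun j => I.vars j 2) (fun j => I.vars j 3)) := by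
  rw [mem_rad]
  intro y
  rw [polar_apply]
  refine sum_eq_zero fun j hj => ?_
  have h2 : (Pi.single v (1 : ZMod 2) : Fin n → ZMod 2) (I.vars j 2) = 0 := by
    rw [Pi.single_apply, if_neg]
    intro h
    exact hv j hj ((mem_andPair_iff I j v).2 (Or.inl h.symm))
  have h3 : (Pi.single v (1 : ZMod 2) : Fin n → ZMod 2) (I.vars j 3) = 0 := by
    rw [Pi.single_apply, if_neg]
    intro h
    exact hv j hj ((mem_andPair_iff I j v).2 (Or.inr h.symm))
  rw [h2, h3, zero_mul, zero_mul, add_zero]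

/-- **No literal off the path**: a variable `v` with `ℓ₁(e_v) ≠ 0` or `ℓ₂(e_v) ≠ 0` is an AND variable of some output of `P`. -/
theorem exists_mem_andPair_of_lit (hrank : finrank (ZMod 2) (rad (polar P (fun j => I.vars j 2) (fun j => I.vars j 3))) + 4 ≤
      finrank (ZMod 2) (Fin n → ZMod 2)) {v : Fin n}
    (hv : linPart hμ₁ (Pi.single v 1) ≠ 0 ∨ linPart hμ₂ (Pi.single v 1) ≠ 0) : ∃ j ∈ P, v ∈ andPair I j := by
  by_contra hno
  push Not at hno
  have hmem := single_mem_rad (I := I) (P := P) hno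
  rw [rad_eq_kers hμ₁ hμ₂ hm₁ hm₂ hQ hrank, mem_kers] at hmem
  rcases hv with h | h
  · exact h hmem.1
  · exact h hmem.2.2.1

/-- **Adjacency read off the linear parts**: for variables `v, w`,
`ℓ₁(e_v)n₁(e_w) + ℓ₁(e_w)n₁(e_v) + ℓ₂(e_v)n₂(e_w) + ℓ₂(e_w)n₂(e_v) = [v, w AND-adjacent in P]`. -/
theorem adj_eq (hI : I.IsPure xorAndPred) (hS : SimpleOverlap I) (v w : Fin n) :
    linPart hμ₁ (Pi.single v 1) * linPart hm₁ (Pi.single w 1) + linPart hμ₁ (Pi.single w 1) * linPart hm₁ (Pi.single v 1) +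
      (linPart hμ₂ (Pi.single v 1) * linPart hm₂ (Pi.single w 1) + linPart hμ₂ (Pi.single w 1) * linPart hm₂ (Pi.single v 1)) =
      if AndAdj I P v w then 1 else 0 := by
  classical
  rw [← polar_basis I hI hS P v w, polar_eq hμ₁ hμ₂ hm₁ hm₂ hQ, LinearMap.add_apply, LinearMap.add_apply, symForm_apply,
    symForm_apply]

/-- **No induced matching of size three** in the AND graph of `P` (the coordinate span of an induced matching misses the radical,
which has codimension at most four). -/
theorem card_le_two_of_isInducedMatching {M : Finset (Fin m)} (hM : IsInducedMatching P M (fun j => I.vars j 2) (fun j => I.vars j 3)) :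
    M.card ≤ 2 := by
  classical
  set B : LinearMap.BilinForm (ZMod 2) (Fin n → ZMod 2) := polar P (fun j => I.vars j 2) (fun j => I.vars j 3) with hBdef
  set S : Submodule (ZMod 2) (Fin n → ZMod 2) :=
    Submodule.span (ZMod 2) (Set.range fun c : cover M (fun j => I.vars j 2) (fun j => I.vars j 3) => Pi.single (c : Fin n) (1 : ZMod 2))
    with hS
  have hScard : finrank (ZMod 2) S = (cover M (fun j => I.vars j 2) (fun j => I.vars j 3)).card := by
    rw [hS, finrank_span_eq_card, Fintype.card_coe]
    exact (Pi.linearIndependent_single_one (Fin n) (ZMod 2)).comp _ Subtype.val_injective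
  have hker : LinearMap.ker B ⊓ S = ⊥ := hM.ker_inf_span_eq_bot
  have h3 : finrank (ZMod 2) (LinearMap.ker B) + finrank (ZMod 2) S ≤ finrank (ZMod 2) (Fin n → ZMod 2) := by
    have e := Submodule.finrank_sup_add_finrank_inf_eq (LinearMap.ker B) S
    rw [hker, finrank_bot, add_zero] at e
    rw [← e]
    exact Submodule.finrank_le _
  have hcov : (cover M (fun j => I.vars j 2) (fun j => I.vars j 3)).card = 2 * M.card := hM.card_cover
  have hN : finrank (ZMod 2) (Fin n → ZMod 2) = n := by rw [Module.finrank_pi, Fintype.card_fin]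
  have hrad : n ≤ finrank (ZMod 2) (LinearMap.ker B) + 4 := le_finrank_rad_add_four hμ₁ hμ₂ hm₁ hm₂ hQ
  omega

omit hμ₁ hμ₂ hm₁ hm₂ hQ in
/-- **`|P| ≥ 2`** under the rank hypothesis: the radical of the AND-sum of at most one output has codimension at most two. -/
theorem two_le_card (hrank : finrank (ZMod 2) (rad (polar P (fun j => I.vars j 2) (fun j => I.vars j 3))) + 4 ≤
      finrank (ZMod 2) (Fin n → ZMod 2)) : 2 ≤ P.card := by
  classical
  by_contra hlt
  have hle : P.card ≤ 1 := by omega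
  have hn : finrank (ZMod 2) (Fin n → ZMod 2) = n := by rw [Module.finrank_pi, Fintype.card_fin]
  rw [hn] at hrank
  -- the radical contains every coordinate vector off the (at most two) AND variables of `P`
  set B : LinearMap.BilinForm (ZMod 2) (Fin n → ZMod 2) := polar P (fun j => I.vars j 2) (fun j => I.vars j 3) with hBdef
  set C : Finset (Fin n) := P.biUnion fun j => andPair I j with hC
  have hCcard : C.card ≤ 2 := by
    calc C.card ≤ ∑ j ∈ P, (andPair I j).card := card_biUnion_le
      _ ≤ ∑ _j ∈ P, 2 := sum_le_sum fun j _ => card_le_two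
      _ = 2 * P.card := by rw [sum_const, smul_eq_mul, mul_comm]
      _ ≤ 2 := by omega
  set S : Submodule (ZMod 2) (Fin n → ZMod 2) :=
    Submodule.span (ZMod 2) (Set.range fun c : ((univ : Finset (Fin n)) \ C : Finset (Fin n)) => Pi.single (c : Fin n) (1 : ZMod 2))
    with hS
  have hScard : finrank (ZMod 2) S = (univ \ C).card := by
    rw [hS, finrank_span_eq_card, Fintype.card_coe]
    exact (Pi.linearIndependent_single_one (Fin n) (ZMod 2)).comp _ Subtype.val_injective
  have hSle : S ≤ rad B := by
    rw [hS, Submodule.span_le]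
    rintro _ ⟨⟨v, hv⟩, rfl⟩
    have hv' : ∀ j ∈ P, v ∉ andPair I j := by
      intro j hj hvj
      exact (mem_sdiff.1 hv).2 (mem_biUnion.2 ⟨j, hj, hvj⟩)
    exact single_mem_rad (I := I) (P := P) hv'
  have h1 : (univ \ C).card ≤ finrank (ZMod 2) (rad B) := hScard ▸ Submodule.finrank_mono hSle
  have h2 : (univ \ C).card + C.card = n := by
    rw [card_sdiff_add_card_eq_card (subset_univ C), card_univ, Fintype.card_fin]
  omega

end Algebra

end Summit.PneNP.PneNP.Theorems.PstarNorUnitPolar
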